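import Literature.AlgebraicGeometry.Deformation.CanonicalRestrictedLiftGluingQuot
import Literature.AlgebraicGeometry.Deformation.SmoothLiftObstructionCocycleQuot
import Literature.AlgebraicGeometry.Deformation.SmoothLiftAtlasQuot
import HarnessLib

/-!
# The indexed lifted atlas: vocabulary ([Hartshorne2010] proof of Thm. 10.2 (a) «`U'_i`, `φ_{ij}`»; [Oort1971] §2.2)

Layer `Literature/AlgebraicGeometry/Deformation`, namespace `Literature.AlgebraicGeometry.Deformation.AtlasQuot`.
DEFINITION FILE = THE SHARED INDEXED-ATLAS BLOCK of the (U-glob) organ (cell `hodgecm-mathlib`, P6b, desk rulings R5∕R6′∕R8; count-neutral):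
vocabulary `res`, `resₐ`, `chartLift`, `gluingOn`, `disc`, `fibreRed`, `readingAut` (+ the canonical closed-fibre instance `fibre`, `fibreQuot`,
`fibreMap`) and its naturality API; no instance, no notation, no named fact, no `sorry`.  Built on the CANONICAL restricted lifts of (U-can)
`CanonicalRestrictedLift{,Gluing}Quot`; consumers ((ii) Čech cocycle, (iv) gluing, (v) closed fibre, (vii) κ-class, (ζ) assembly) IMPORT it.

THE SHARED INDEXED-ATLAS BINDER BLOCK (Hartshorne's «`U'_i`» and «`φ_{ij}`», nothing more):
* the scheme side in FILE B's currency: `[instΓ : ∀ W, Algebra A' Γ(X₀, W)]`, `halg` (restrictions are `A'`-algebra maps);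
* `J` nilpotent; a principal affine cover `V : ι → X₀.affineOpens`, `c a b ∈ Γ(X₀, V a)`, `V a ⊓ V b = D(c a b)`;
* lifts `P a` (flat `A'`-algebras) with reductions `r a : P a →ₐ[A'] Γ(X₀, V a)` onto, `ker (r a) = J·P a`;
* gluings `ψ a b : chartLift r a (V a ⊓ V b) ≃ₐ[A'] chartLift r b (V a ⊓ V b)` compatible with the canonical reductions (`hψ`),
where `chartLift r a W = L(r a, res)` is the CANONICAL restricted lift of (U-can) — so every deeper object (`gluingOn`, `disc`) is a definite
term, and cochains are functions of the indices (`ι : Type*`, any universe; finiteness only where a Čech group needs it);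
* the CLOSED-FIBRE layer, ABSTRACT (R8): rings `B W` with `π W : Γ(X₀, W) ↠ B W`, `ker = 𝔪 Γ(X₀, W)` on principal opens of charts, and
  restriction maps `g`, `π`-compatible — instantiated by the gluing side at `Γ(X₀, W) ⧸ 𝔪 Γ(X₀, W)` (§3b) and by the κ-side at the sections of
  `X₀ ×_{A'⧸J} κ`; readings are CHARACTERISED through `readingAut … δ = disc …` (★ (χ2) `autOfClosedFibreDerivation`).

HC_CM is proved only modulo the printed citations until rung 0 closes; nothing here bears on a summit statement.
## References
* [Hartshorne2010] R. Hartshorne, *Deformation Theory*, GTM 257, Springer (2010): Thm. 10.2 (a) and its proof (p. 81).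
* [Oort1971] F. Oort, *Finite group schemes, local moduli for abelian varieties, and lifting problems*, Compositio Math. 23 (1971),
  §2.2 (pp. 277–279), Lemma (2.2.4) (p. 274).
* [StacksProject] The Stacks Project, Tag 01I2 (sections over a basic open of an affine are a localisation), Tag 00CP.
-/

noncomputable section

-- `TopCat.Presheaf`/`TopCat.Sheaf` are not reducible (as in Mathlib's `AlgebraicGeometry/Modules`).
set_option backward.isDefEq.respectTransparency false

open CategoryTheory AlgebraicGeometry Opposite TopologicalSpace
open scoped TensorProduct

universe u

namespace Literature.AlgebraicGeometry.Deformation.AtlasQuot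

open Literature.AlgebraicGeometry.Deformation.CanonicalLiftQuot Literature.AlgebraicGeometry.Deformation.ExtensionAutomorphismsQuot
  Literature.AlgebraicGeometry.Deformation.LiftObstructionCocycleQuot Literature.AlgebraicGeometry.Deformation.LiftGluingSuppliersQuot

variable {A' : Type u} [CommRing A'] {X₀ : Scheme.{u}} [instΓ : ∀ W : X₀.Opens, Algebra A' Γ(X₀, W)]
  (halg : ∀ (W V : X₀.Opens) (e : V ≤ W) (a : A'), X₀.presheaf.map (homOfLE e).op (algebraMap A' Γ(X₀, W) a) = algebraMap A' Γ(X₀, V) a)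

/-! ## §0 Restriction maps -/

/-- The restriction ring hom `Γ(X₀, W) → Γ(X₀, V)` for `V ≤ W`. [cite: Hartshorne2010, Thm. 10.2 (a) (proof), p. 81] -/
abbrev res {W V : X₀.Opens} (h : V ≤ W) : Γ(X₀, W) →+* Γ(X₀, V) := (X₀.presheaf.map (homOfLE h).op).hom

omit instΓ in
/-- Restriction in two steps. [cite: StacksProject, Tag 01I2] -/
theorem res_res {W V V' : X₀.Opens} (h : V ≤ W) (h' : V' ≤ V) (q : Γ(X₀, W)) :
    res (X₀ := X₀) (h'.trans h) q = res h' (res h q) := by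
  change (X₀.presheaf.map (homOfLE (h'.trans h)).op) q = (X₀.presheaf.map (homOfLE h).op ≫ X₀.presheaf.map (homOfLE h').op) q
  rw [← X₀.presheaf.map_comp]
  rfl

include halg in
/-- Restriction is compatible with the `A'`-structures (`halg`). [cite: Hartshorne2010, Thm. 10.2 (a) (proof), p. 81] -/
theorem res_algebraMap {W V : X₀.Opens} (h : V ≤ W) (a : A') : res h (algebraMap A' Γ(X₀, W) a) = algebraMap A' Γ(X₀, V) a :=
  halg W V h a

/-- The restriction as an `A'`-algebra hom. [cite: Hartshorne2010, Thm. 10.2 (a) (proof), p. 81] -/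
def resₐ {W V : X₀.Opens} (h : V ≤ W) : Γ(X₀, W) →ₐ[A'] Γ(X₀, V) := AlgHom.mk (res h) (halg W V h)

/-! ## §1 The charts: canonical restricted lifts of the local lifts -/

section Atlas

variable {J : Ideal A'} (hJ : IsNilpotent J) {ι : Type*} (V : ι → X₀.affineOpens) (c : (a b : ι) → Γ(X₀, (V a).1))
  (hc : ∀ a b, (V a).1 ⊓ (V b).1 = X₀.basicOpen (c a b))
  {P : ι → Type u} [∀ a, CommRing (P a)] [∀ a, Algebra A' (P a)]
  (r : (a : ι) → P a →ₐ[A'] Γ(X₀, (V a).1)) (hr : ∀ a, Function.Surjective (r a))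
  (hkr : ∀ a, RingHom.ker (r a) = J.map (algebraMap A' (P a)))

/-- **The chart lift on a smaller open:** the canonical restricted lift `L(r a, res)` of the `a`-th local lift to `W ⊆ V a` ((U-can)).
[cite: Hartshorne2010, Thm. 10.2 (a) (proof), p. 81] [cite: Oort1971, Lemma (2.2.4) (p. 274)] -/
abbrev chartLift (a : ι) {W : X₀.Opens} (h : W ≤ (V a).1) : Type u := CanonicalLift (r a) (res h)

omit instΓ in
include hc in
/-- `V a ⊓ V b ⊓ V d = D(c a b · c a d)` as an open of the affine `V a`. [cite: StacksProject, Tag 01I2] -/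
theorem inf₃_eq_basicOpen₁ (a b d : ι) : (V a).1 ⊓ (V b).1 ⊓ (V d).1 = X₀.basicOpen (c a b * c a d) := by
  rw [Scheme.basicOpen_mul, ← hc, ← hc]
  exact le_antisymm (le_inf inf_le_left (le_inf (inf_le_left.trans inf_le_left) inf_le_right))
    (le_inf inf_le_left (inf_le_right.trans inf_le_right))

omit instΓ in
include hc in
/-- `V a ⊓ V b ⊓ V d = D(c b a · c b d)` as an open of the affine `V b`. [cite: StacksProject, Tag 01I2] -/
theorem inf₃_eq_basicOpen₂ (a b d : ι) : (V a).1 ⊓ (V b).1 ⊓ (V d).1 = X₀.basicOpen (c b a * c b d) := by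
  rw [Scheme.basicOpen_mul, ← hc, ← hc]
  exact le_antisymm (le_inf (le_inf (inf_le_left.trans inf_le_right) (inf_le_left.trans inf_le_left))
      (le_inf (inf_le_left.trans inf_le_right) inf_le_right))
    (le_inf (le_inf (inf_le_left.trans inf_le_right) (inf_le_left.trans inf_le_left)) (inf_le_right.trans inf_le_right))

omit instΓ in
include hc in
/-- `V a ⊓ V b ⊓ V d = D(c d a · c d b)` as an open of the affine `V d`. [cite: StacksProject, Tag 01I2] -/
theorem inf₃_eq_basicOpen₃ (a b d : ι) : (V a).1 ⊓ (V b).1 ⊓ (V d).1 = X₀.basicOpen (c d a * c d b) := by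
  rw [Scheme.basicOpen_mul, ← hc, ← hc]
  exact le_antisymm (le_inf (le_inf inf_le_right (inf_le_left.trans inf_le_left)) (le_inf inf_le_right (inf_le_left.trans inf_le_right)))
    (le_inf (le_inf (inf_le_left.trans inf_le_right) (inf_le_right.trans inf_le_right)) (inf_le_left.trans inf_le_left))

/-! ## §2 The gluings on deeper opens and the triple discrepancies (choice-free) -/

variable (ψ : (a b : ι) → chartLift V r a (inf_le_left : (V a).1 ⊓ (V b).1 ≤ (V a).1) ≃ₐ[A']
    chartLift V r b (inf_le_right : (V a).1 ⊓ (V b).1 ≤ (V b).1))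
  (hψ : ∀ a b x, reduction (r b) (res (inf_le_right : (V a).1 ⊓ (V b).1 ≤ (V b).1)) (halg _ _ _) (ψ a b x) =
    reduction (r a) (res (inf_le_left : (V a).1 ⊓ (V b).1 ≤ (V a).1)) (halg _ _ _) x)

/-- **The gluing `ψ a b` restricted to a principal open `W ⊆ V a`, `W ⊆ V b`** (principal on both charts — `Prop`s, so `gluingOn a b W …` is
ONE term whatever equations are in mind, typed `chartLift V r a ha ≃ₐ[A'] chartLift V r b hb` on the nose): the canonical restricted gluing of
(U-can) II. [cite: Hartshorne2010, Thm. 10.2 (a) (proof), p. 81] [cite: Oort1971, Lemma (2.2.4) (p. 274)] -/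
def gluingOn (a b : ι) (W : X₀.Opens) (ha : W ≤ (V a).1) (hb : W ≤ (V b).1) (pa : ∃ q : Γ(X₀, (V a).1), W = X₀.basicOpen q)
    (pb : ∃ q : Γ(X₀, (V b).1), W = X₀.basicOpen q) :
    chartLift V r a ha ≃ₐ[A'] chartLift V r b hb :=
  gluingRestrict hJ (r a) (hr a) (hkr a) (r b) (hr b) (hkr b)
    (res (inf_le_left : (V a).1 ⊓ (V b).1 ≤ (V a).1)) (halg _ _ _) (res (inf_le_right : (V a).1 ⊓ (V b).1 ≤ (V b).1)) (halg _ _ _)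
    (res ha) (halg _ _ _) (res hb) (halg _ _ _) (res (le_inf ha hb))
    (fun q => res_res inf_le_left (le_inf ha hb) q) (fun q => res_res inf_le_right (le_inf ha hb) q)
    (pa.elim fun q hq => ⟨q, (V a).2.isLocalization_of_eq_basicOpen q (homOfLE ha) hq⟩)
    (pb.elim fun q hq => ⟨q, (V b).2.isLocalization_of_eq_basicOpen q (homOfLE hb) hq⟩) (ψ a b) (hψ a b)

/-- **The triple discrepancy** `ψ_{ad}|⁻¹ ∘ ψ_{bd}| ∘ ψ_{ab}|` on `V a ⊓ V b ⊓ V d`, an automorphism of the chart-`a` lift there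
(convention of ★ (U-coc)∕FILE A∕B: `ψ₁₂.trans (ψ₂₃.trans ψ₁₃.symm)`). [cite: Hartshorne2010, Thm. 10.2 (a) (proof), p. 81]
[cite: Oort1971, §2.2 (pp. 277–279)] -/
def disc (a b d : ι) :
    chartLift V r a (inf_le_left.trans inf_le_left : (V a).1 ⊓ (V b).1 ⊓ (V d).1 ≤ (V a).1) ≃ₐ[A']
      chartLift V r a (inf_le_left.trans inf_le_left : (V a).1 ⊓ (V b).1 ⊓ (V d).1 ≤ (V a).1) :=
  (gluingOn halg hJ V r hr hkr ψ hψ a b ((V a).1 ⊓ (V b).1 ⊓ (V d).1) (inf_le_left.trans inf_le_left) (inf_le_left.trans inf_le_right)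
      ⟨_, inf₃_eq_basicOpen₁ V c hc a b d⟩ ⟨_, inf₃_eq_basicOpen₂ V c hc a b d⟩).trans
    ((gluingOn halg hJ V r hr hkr ψ hψ b d ((V a).1 ⊓ (V b).1 ⊓ (V d).1) (inf_le_left.trans inf_le_right) inf_le_right
        ⟨_, inf₃_eq_basicOpen₂ V c hc a b d⟩ ⟨_, inf₃_eq_basicOpen₃ V c hc a b d⟩).trans
      (gluingOn halg hJ V r hr hkr ψ hψ a d ((V a).1 ⊓ (V b).1 ⊓ (V d).1) (inf_le_left.trans inf_le_left) inf_le_right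
        ⟨_, inf₃_eq_basicOpen₁ V c hc a b d⟩ ⟨_, inf₃_eq_basicOpen₃ V c hc a b d⟩).symm)

/-! ## §3 The closed-fibre layer (abstract, R8) and the readings' characterisation -/

variable (𝔪 : Ideal A') {B : X₀.Opens → Type u} [∀ W, CommRing (B W)] [∀ W, Algebra A' (B W)] (π : (W : X₀.Opens) → Γ(X₀, W) →ₐ[A'] B W)
  (hπ : ∀ (a : ι) (W : X₀.Opens), W ≤ (V a).1 → (∃ q : Γ(X₀, (V a).1), W = X₀.basicOpen q) →
    Function.Surjective (π W) ∧ RingHom.ker (π W) = 𝔪.map (algebraMap A' Γ(X₀, W)))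
  (g : ∀ ⦃W W' : X₀.Opens⦄, W' ≤ W → (B W →ₐ[A'] B W'))
  (hg : ∀ ⦃W W' : X₀.Opens⦄ (h : W' ≤ W) (x : Γ(X₀, W)), g h (π W x) = π W' (res h x))

/-- The reduction of the chart-`a` lift on `W` all the way to the closed fibre: `L(r a, res) ↠ Γ(X₀, W) ↠ B W`.
[cite: Hartshorne2010, Thm. 10.2 (a) (proof), p. 81] -/
def fibreRed (a : ι) {W : X₀.Opens} (h : W ≤ (V a).1) : chartLift V r a h →ₐ[A'] B W :=
  (π W).comp (reduction (r a) (res h) (halg _ _ h))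

include hJ hr hkr hπ in
/-- `fibreRed` is onto (for `W` principal in `V a`). [cite: Hartshorne2010, Thm. 10.2 (a) (proof), p. 81] -/
theorem fibreRed_surjective (a : ι) {W : X₀.Opens} (h : W ≤ (V a).1) (hq : ∃ q : Γ(X₀, (V a).1), W = X₀.basicOpen q) :
    Function.Surjective (fibreRed halg V r π a h) := by
  obtain ⟨q, hq'⟩ := hq
  exact surjective_comp _ (reduction_surjective hJ (r a) (hr a) (hkr a) (res h) (halg _ _ h)
    ((V a).2.isLocalization_of_eq_basicOpen q (homOfLE h) hq')) _ (hπ a W h ⟨q, hq'⟩).1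

include hJ hr hkr hπ in
/-- `ker fibreRed = 𝔪 · L` (for `W` principal in `V a`, `J ≤ 𝔪`). [cite: Hartshorne2010, Thm. 10.2 (a) (proof), p. 81] -/
theorem ker_fibreRed (hJ𝔪 : J ≤ 𝔪) (a : ι) {W : X₀.Opens} (h : W ≤ (V a).1) (hq : ∃ q : Γ(X₀, (V a).1), W = X₀.basicOpen q) :
    RingHom.ker (fibreRed halg V r π a h) = 𝔪.map (algebraMap A' (chartLift V r a h)) := by
  obtain ⟨q, hq'⟩ := hq
  exact ker_comp_eq_map 𝔪 J hJ𝔪 _ (reduction_surjective hJ (r a) (hr a) (hkr a) (res h) (halg _ _ h)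
      ((V a).2.isLocalization_of_eq_basicOpen q (homOfLE h) hq'))
    (ker_reduction hJ (r a) (hr a) (hkr a) (res h) (halg _ _ h) ((V a).2.isLocalization_of_eq_basicOpen q (homOfLE h) hq')) _
    (hπ a W h ⟨q, hq'⟩).2

/-- **The automorphism `θ_δ` of a chart lift attached to a closed-fibre derivation** (★ (χ2) `autOfClosedFibreDerivation` for the reduction
`fibreRed`, on a principal `W ⊆ V a`) — the shape in which readings are CHARACTERISED (`readingAut … δ = disc …`).
[cite: Hartshorne2010, Thm. 10.2 (a) (proof), p. 81] -/
abbrev readingAut (h𝔪J : 𝔪 * J = ⊥) (hJ𝔪 : J ≤ 𝔪) [∀ a, Module.Flat A' (P a)] (a : ι) {W : X₀.Opens} (h : W ≤ (V a).1)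
    (hq : ∃ q : Γ(X₀, (V a).1), W = X₀.basicOpen q) (δ : Derivation A' (B W) (B W ⊗[A'] ↥J)) :
    chartLift V r a h ≃ₐ[A'] chartLift V r a h :=
  haveI := CanonicalLiftQuot.flat (r a) (res h)
  autOfClosedFibreDerivation 𝔪 J h𝔪J hJ𝔪 (fibreRed halg V r π a h) (fibreRed_surjective halg hJ V r hr hkr 𝔪 π hπ a h hq)
    (ker_fibreRed halg hJ V r hr hkr 𝔪 π hπ hJ𝔪 a h hq) δ

/-! ## §3b The canonical instance of the closed-fibre layer: `Γ(X₀, W) ⧸ 𝔪 Γ(X₀, W)` -/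

/-- **The closed-fibre ring of an open:** `Γ(X₀, W) ⧸ 𝔪·Γ(X₀, W)`. [cite: Hartshorne2010, Thm. 10.2 (a) (proof), p. 81] -/
abbrev fibre (W : X₀.Opens) : Type u := Γ(X₀, W) ⧸ 𝔪.map (algebraMap A' Γ(X₀, W))

/-- Its quotient map (the `π` of the canonical instance). [cite: Hartshorne2010, Thm. 10.2 (a) (proof), p. 81] -/
abbrev fibreQuot (W : X₀.Opens) : Γ(X₀, W) →ₐ[A'] fibre 𝔪 W := Ideal.Quotient.mkₐ A' _

/-- The canonical instance satisfies `hπ` (on every open). [cite: Hartshorne2010, Thm. 10.2 (a) (proof), p. 81] -/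
theorem fibreQuot_surjective_ker (W : X₀.Opens) :
    Function.Surjective (fibreQuot (X₀ := X₀) 𝔪 W) ∧ RingHom.ker (fibreQuot (X₀ := X₀) 𝔪 W) = 𝔪.map (algebraMap A' Γ(X₀, W)) :=
  ⟨Ideal.Quotient.mkₐ_surjective A' _, Ideal.Quotient.mkₐ_ker A' _⟩

/-- The closed-fibre restriction `Γ(X₀, W) ⧸ 𝔪 → Γ(X₀, W′) ⧸ 𝔪` for `W′ ≤ W` (the `g` of the canonical instance).
[cite: Hartshorne2010, Thm. 10.2 (a) (proof), p. 81] -/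
def fibreMap {W W' : X₀.Opens} (h : W' ≤ W) : fibre 𝔪 W →ₐ[A'] fibre 𝔪 W' :=
  Ideal.quotientMapₐ _ (resₐ halg h) (Ideal.map_le_iff_le_comap.mpr fun a ha => by
    rw [Ideal.mem_comap, Ideal.mem_comap, AlgHom.commutes]
    exact Ideal.mem_map_of_mem _ ha)

/-- The canonical instance satisfies `hg`. [cite: Hartshorne2010, Thm. 10.2 (a) (proof), p. 81] -/
theorem fibreMap_fibreQuot {W W' : X₀.Opens} (h : W' ≤ W) (x : Γ(X₀, W)) :
    fibreMap halg 𝔪 h (fibreQuot 𝔪 W x) = fibreQuot 𝔪 W' (res h x) :=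
  rfl

/-! ## §4 Naturality of the atlas data under restriction -/

omit instΓ in
include hc in
/-- `V a ⊓ V b ⊓ V d ⊓ V e = D(c a b · c a d · c a e)` as an open of the affine `V a`. [cite: StacksProject, Tag 01I2] -/
theorem inf₄_eq_basicOpen (a b d e : ι) :
    (V a).1 ⊓ (V b).1 ⊓ (V d).1 ⊓ (V e).1 = X₀.basicOpen (c a b * c a d * c a e) := by
  rw [Scheme.basicOpen_mul, Scheme.basicOpen_mul, ← hc, ← hc, ← hc]
  exact le_antisymm
    (le_inf (le_inf (le_inf (inf_le_left.trans (inf_le_left.trans inf_le_left)) (inf_le_left.trans (inf_le_left.trans inf_le_right)))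
      (le_inf (inf_le_left.trans (inf_le_left.trans inf_le_left)) (inf_le_left.trans inf_le_right)))
      (le_inf (inf_le_left.trans (inf_le_left.trans inf_le_left)) inf_le_right))
    (le_inf (le_inf (le_inf (inf_le_left.trans (inf_le_left.trans inf_le_left)) (inf_le_left.trans (inf_le_left.trans inf_le_right)))
      (inf_le_left.trans (inf_le_right.trans inf_le_right))) (inf_le_right.trans inf_le_right))

/-- **The restricted gluing intertwines the canonical restrictions** (`ψ|_{W} (x|) = (ψ x)|`). [cite: Hartshorne2010, Thm. 10.2 (a) (proof), p. 81] -/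
theorem gluingOn_restrict (a b : ι) (W : X₀.Opens) (ha : W ≤ (V a).1) (hb : W ≤ (V b).1) (pa : ∃ q : Γ(X₀, (V a).1), W = X₀.basicOpen q)
    (pb : ∃ q : Γ(X₀, (V b).1), W = X₀.basicOpen q) (x : chartLift V r a (inf_le_left : (V a).1 ⊓ (V b).1 ≤ (V a).1)) :
    gluingOn halg hJ V r hr hkr ψ hψ a b W ha hb pa pb
        (restrict (r a) (res (inf_le_left : (V a).1 ⊓ (V b).1 ≤ (V a).1)) (res ha)
          (liftSubmonoid_mono _ _ _ (res (le_inf ha hb)) fun q => res_res inf_le_left (le_inf ha hb) q) x) =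
      restrict (r b) (res (inf_le_right : (V a).1 ⊓ (V b).1 ≤ (V b).1)) (res hb)
        (liftSubmonoid_mono _ _ _ (res (le_inf ha hb)) fun q => res_res inf_le_right (le_inf ha hb) q) (ψ a b x) :=
  gluingRestrict_restrict hJ (r a) (hr a) (hkr a) (r b) (hr b) (hkr b) _ _ _ _ _ _ _ _ _ _ _ _ _ (ψ a b) (hψ a b) x

/-- **Naturality of the restricted gluings under further restriction** `W′ ⊆ W`: `(ψ|_W y)|_{W′} = ψ|_{W′} (y|_{W′})` (uniqueness of
maps out of the localisation `L(r a, res_W)` of `L(r a, res_{V a ⊓ V b})`). [cite: Hartshorne2010, Thm. 10.2 (a) (proof), p. 81]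
[cite: StacksProject, Tag 00CP] -/
theorem gluingOn_naturality (a b : ι) (W W' : X₀.Opens) (ha : W ≤ (V a).1) (hb : W ≤ (V b).1) (hW'W : W' ≤ W)
    (ha' : W' ≤ (V a).1) (hb' : W' ≤ (V b).1)
    (pa : ∃ q : Γ(X₀, (V a).1), W = X₀.basicOpen q) (pb : ∃ q : Γ(X₀, (V b).1), W = X₀.basicOpen q)
    (pa' : ∃ q : Γ(X₀, (V a).1), W' = X₀.basicOpen q) (pb' : ∃ q : Γ(X₀, (V b).1), W' = X₀.basicOpen q) (y : chartLift V r a ha) :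
    restrict (r b) (res hb) (res hb') (liftSubmonoid_mono _ _ _ (res hW'W) fun q => res_res hb hW'W q)
        (gluingOn halg hJ V r hr hkr ψ hψ a b W ha hb pa pb y) =
      gluingOn halg hJ V r hr hkr ψ hψ a b W' ha' hb' pa' pb'
        (restrict (r a) (res ha) (res ha') (liftSubmonoid_mono _ _ _ (res hW'W) fun q => res_res ha hW'W q) y) := by
  have key := algHom_ext_restrict (r a) (res (inf_le_left : (V a).1 ⊓ (V b).1 ≤ (V a).1)) (res ha)
    (liftSubmonoid_mono _ _ _ (res (le_inf ha hb)) fun q => res_res inf_le_left (le_inf ha hb) q)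
    ((restrict (r b) (res hb) (res hb') (liftSubmonoid_mono _ _ _ (res hW'W) fun q => res_res hb hW'W q)).comp
      (gluingOn halg hJ V r hr hkr ψ hψ a b W ha hb pa pb : _ →ₐ[A'] _))
    ((gluingOn halg hJ V r hr hkr ψ hψ a b W' ha' hb' pa' pb' : _ →ₐ[A'] _).comp
      (restrict (r a) (res ha) (res ha') (liftSubmonoid_mono _ _ _ (res hW'W) fun q => res_res ha hW'W q)))
    fun x => by
      rw [AlgHom.comp_apply, AlgHom.comp_apply, AlgEquiv.coe_toAlgHom, AlgEquiv.coe_toAlgHom, gluingOn_restrict, restrict_restrict,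
        restrict_restrict, ← gluingOn_restrict halg hJ V r hr hkr ψ hψ a b W' ha' hb' pa' pb' x]
  exact congrArg (fun f : _ →ₐ[A'] _ => f y) key

/-- The restricted gluings are REDUCTION-COMPATIBLE. [cite: Hartshorne2010, Thm. 10.2 (a) (proof), p. 81] -/
theorem reduction_gluingOn (a b : ι) (W : X₀.Opens) (ha : W ≤ (V a).1) (hb : W ≤ (V b).1)
    (pa : ∃ q : Γ(X₀, (V a).1), W = X₀.basicOpen q) (pb : ∃ q : Γ(X₀, (V b).1), W = X₀.basicOpen q) (y : chartLift V r a ha) :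
    reduction (r b) (res hb) (halg _ _ _) (gluingOn halg hJ V r hr hkr ψ hψ a b W ha hb pa pb y) = reduction (r a) (res ha) (halg _ _ _) y :=
  reduction_gluingRestrict hJ (r a) (hr a) (hkr a) (r b) (hr b) (hkr b) _ _ _ _ _ _ _ _ _ _ _ _ _ (ψ a b) (hψ a b) y

/-- … hence compatible with the closed-fibre reductions `fibreRed`. [cite: Hartshorne2010, Thm. 10.2 (a) (proof), p. 81] -/
theorem fibreRed_gluingOn (a b : ι) (W : X₀.Opens) (ha : W ≤ (V a).1) (hb : W ≤ (V b).1)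
    (pa : ∃ q : Γ(X₀, (V a).1), W = X₀.basicOpen q) (pb : ∃ q : Γ(X₀, (V b).1), W = X₀.basicOpen q) (y : chartLift V r a ha) :
    fibreRed halg V r π b hb (gluingOn halg hJ V r hr hkr ψ hψ a b W ha hb pa pb y) = fibreRed halg V r π a ha y := by
  change π W (reduction _ _ _ _) = π W (reduction _ _ _ _)
  rw [reduction_gluingOn halg hJ V r hr hkr ψ hψ a b W ha hb pa pb y]

include hg in
/-- The closed-fibre reductions commute with restriction: `fibreRed (y|) = (fibreRed y)|`. [cite: Hartshorne2010, Thm. 10.2 (a) (proof), p. 81] -/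
theorem fibreRed_restrict (a : ι) {W W' : X₀.Opens} (h : W ≤ (V a).1) (hW'W : W' ≤ W) (y : chartLift V r a h) :
    fibreRed halg V r π a (hW'W.trans h)
        (restrict (r a) (res h) (res (hW'W.trans h)) (liftSubmonoid_mono _ _ _ (res hW'W) fun q => res_res h hW'W q) y) =
      g hW'W (fibreRed halg V r π a h y) := by
  change π W' (reduction _ _ _ _) = g hW'W (π W (reduction _ _ _ _))
  rw [hg, reduction_restrict (r a) (res h) (halg _ _ _) (res (hW'W.trans h)) (halg _ _ _) (res hW'W) fun q => res_res h hW'W q]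

/-! ## §5 The Čech 2-cocycle identity on a quadruple overlap -/

end Atlas

end Literature.AlgebraicGeometry.Deformation.AtlasQuot

end
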